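import Summits.CriticalPhenomena.PercolationContinuityZ3.Theorems.PercNearOneGluingNoHeavyLowerTailJBernSunflowerKleitmanTwoPetalIC
import HarnessLib

/-!
# `NoHeavyLowerTail` (crux stmt-CriticalPhenomena-4575), hull-port line hp-7: the IC two-orientation theorem in the `Sunflower` vocabulary —
# a STAR of W-Λ pairs at one petal, both orientations mixed

Support file (prover `prim-hp-7`, generation 50; `--supports stmt-CriticalPhenomena-4575`).  No definitions, no `sorry`, standard axioms.
Memo: `prim-hp-7/FROM-prim-hp-7-g50-IC-KLEITMAN.md` §3 (Theorem A').  Corollary of `JBern.card_filter_le_card_filter_target_of_intersecting`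
(`…JBernSunflowerKleitmanTwoPetalIC`) with `U₁ = V i` (the hub petal's up-set) and `U₂ = V j ∪ V k` (the two other up-sets merged).

For a sunflower `F` of three up-sets `V 0, V 1, V 2` with kernel `A` (prim-ineq-prove-1 / prim-l12-p2's `SunflowerPartition.Sunflower`), a hub index `i` and the
two other indices `j, k`, and a family `S` of antipodal middle pairs each of which has one end in the hub petal `V i ∖ A` and the other end in `(V j ∪ V k) ∖ A` — in EITHER
order — and which is intersecting and co-intersecting: for every up-set `𝒰`,
  `#(S ∩ 𝒰) ≤ #{t ∈ 𝒰 : t ∈ A, univ∖t ∉ V i ∪ V j ∪ V k}`   (`JBern.sunflower_card_filter_le_of_intersecting`).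
Percolation reading (fibre minor, `V 0 = {o~x}, V 1 = {o~v}, V 2 = {x~v}`, petals `O′, E, PV`, kernel `T`, bottom `PM`): with hub `PV`, any intersecting + co-intersecting
selection of pairs from `N(PV,O′) ∪ N(PV,E) ∪ N(O′,PV) ∪ N(E,PV)` is matched increasingly into `N(T,PM)` — four of the six ordered petal pairs at once, beyond every
orientation (transitive or cyclic uses three).  The cyclic transversal `N(O′,E)+N(E,PV)+N(PV,O′)` itself is not a star and stays open. [this work]
-/

namespace Summit.CriticalPhenomena.PercolationContinuityZ3.Theorems.JBern

open Finset
open Summit.CriticalPhenomena.PercolationContinuityZ3.Theorems.SunflowerPartition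

variable {α : Type*} [Fintype α] [DecidableEq α]

omit [Fintype α] in
/-- The kernel lies in every `V i`. [this work] -/
theorem sunflower_A_subset_V (F : Sunflower α) (i : Fin 3) {x : Finset α} (hx : x ∈ F.A) : x ∈ F.V i := by
  obtain ⟨j, hj⟩ : ∃ j : Fin 3, j ≠ i := by
    by_cases h : i = 0
    · exact ⟨1, by rw [h]; decide⟩
    · exact ⟨0, fun h0 => h h0.symm⟩
  have h : x ∈ F.V i ∩ F.V j := by rw [F.inter_eq i j hj.symm]; exact hx
  exact (mem_inter.1 h).1

/-- **Star of W-Λ pairs at a hub petal, both orientations, IC families** (this work).  See the module docstring.  Instance of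
`card_filter_le_card_filter_target_of_intersecting` with `U₁ = F.V i`, `U₂ = F.V j ∪ F.V k`. [this work] -/
theorem sunflower_card_filter_le_of_intersecting (F : Sunflower α) {i j k : Fin 3} (hij : i ≠ j) (hik : i ≠ k)
    (S : Finset (Finset α))
    (hS : ∀ ζ ∈ S, ζ ∉ F.A ∧ univ \ ζ ∉ F.A ∧
      ((ζ ∈ F.V i ∧ (univ \ ζ ∈ F.V j ∨ univ \ ζ ∈ F.V k)) ∨ ((ζ ∈ F.V j ∨ ζ ∈ F.V k) ∧ univ \ ζ ∈ F.V i)))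
    (hI : ∀ ζ ∈ S, ∀ ξ ∈ S, (ζ ∩ ξ).Nonempty) (hC : ∀ ζ ∈ S, ∀ ξ ∈ S, ζ ∪ ξ ≠ univ)
    (𝒰 : Finset (Finset α)) (h𝒰 : IsUpperSet (𝒰 : Set (Finset α))) :
    #(S.filter fun ζ => ζ ∈ 𝒰)
      ≤ #(𝒰.filter fun t => t ∈ F.A ∧ univ \ t ∉ F.V i ∧ univ \ t ∉ F.V j ∧ univ \ t ∉ F.V k) := by
  classical
  have hU₁ : IsUpperSet ((F.V i : Finset (Finset α)) : Set (Finset α)) := F.upper i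
  have hU₂ : IsUpperSet ((F.V j ∪ F.V k : Finset (Finset α)) : Set (Finset α)) := by
    intro s t hst hs
    rw [Finset.mem_coe, mem_union] at hs ⊢
    rcases hs with h | h
    · exact Or.inl (F.mem_V_of_subset hst h)
    · exact Or.inr (F.mem_V_of_subset hst h)
  -- translate the source hypothesis
  have hS' : ∀ ζ ∈ S, (ζ ∈ F.V i ∧ ζ ∉ F.V j ∪ F.V k ∧ univ \ ζ ∈ F.V j ∪ F.V k ∧ univ \ ζ ∉ F.V i) ∨
      (ζ ∈ F.V j ∪ F.V k ∧ ζ ∉ F.V i ∧ univ \ ζ ∈ F.V i ∧ univ \ ζ ∉ F.V j ∪ F.V k) := by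
    intro ζ hζ
    obtain ⟨hA, hcA, h⟩ := hS ζ hζ
    rcases h with ⟨hi, hc⟩ | ⟨hζ', hci⟩
    · refine Or.inl ⟨hi, ?_, mem_union.2 hc, ?_⟩
      · intro hm
        rcases mem_union.1 hm with h' | h'
        · exact hA (F.mem_A_of_mem_mem hij hi h')
        · exact hA (F.mem_A_of_mem_mem hik hi h')
      · intro hci
        rcases hc with h' | h'
        · exact hcA (F.mem_A_of_mem_mem hij hci h')
        · exact hcA (F.mem_A_of_mem_mem hik hci h')
    · refine Or.inr ⟨mem_union.2 hζ', ?_, hci, ?_⟩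
      · intro hi
        rcases hζ' with h' | h'
        · exact hA (F.mem_A_of_mem_mem hij hi h')
        · exact hA (F.mem_A_of_mem_mem hik hi h')
      · intro hm
        rcases mem_union.1 hm with h' | h'
        · exact hcA (F.mem_A_of_mem_mem hij hci h')
        · exact hcA (F.mem_A_of_mem_mem hik hci h')
  have main := card_filter_le_card_filter_target_of_intersecting (F.V i) (F.V j ∪ F.V k) hU₁ hU₂ S hS' hI hC 𝒰 h𝒰
  refine main.trans (le_of_eq ?_)
  refine congrArg Finset.card (Finset.filter_congr fun t _ => ?_)
  constructor
  · rintro ⟨hti, htjk, hci, hcjk⟩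
    rw [mem_union, not_or] at hcjk
    refine ⟨?_, hci, hcjk.1, hcjk.2⟩
    rcases mem_union.1 htjk with h' | h'
    · exact F.mem_A_of_mem_mem hij hti h'
    · exact F.mem_A_of_mem_mem hik hti h'
  · rintro ⟨htA, hci, hcj, hck⟩
    refine ⟨sunflower_A_subset_V F i htA, mem_union.2 (Or.inl (sunflower_A_subset_V F j htA)), hci, ?_⟩
    rw [mem_union, not_or]; exact ⟨hcj, hck⟩

end Summit.CriticalPhenomena.PercolationContinuityZ3.Theorems.JBern
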